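import Summits.Ventures.PercRepro.C026BallFlip
import Summits.Ventures.PercRepro.C026DefectFlips

/-!
# mine-3's Theorem M″: far access through a fixed vertex (p5, gen 15)

mine-3 (INBOX 5220, memo §27 add. 3): if `w` is a nearest vertex of the closed `c`-cluster `D = Com_c(S̄)` to the
mark `a`, at open distance `r + 1`, then «flip `D`, seal it except the edges between `w` and the open sphere of
radius `r` around `a`» is injective: `r` is read off the image as the distance from `a` to `w`, the distances
`≤ r` are preserved, and `D` is `c`'s open cluster after deleting the ball. For `w = c` this is **Theorem M″**:
`#{S ∈ N² : dist(a, c) = dist(a, Com_c(S̄))} ≤ #ac|b`; for `w = x` on `DB(xb)` it is the map `M_x^{(k)}` of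
Lemma T. Theorem M (`sealFlip`) is the case `r = 0`.

* `fixFlip w c a r ω` (`M_w^{(r+1)}(S)`), `fixDecode`; `ball_fixFlip_eq`, `atDist_fixFlip_w` (the radius is
  read off the image), `decodeCluster_fixFlip` (`D = Com_c(T − B_r(a))`), **`fixDecode_fixFlip`** (the decoding
  returns the source), `fixFlip_mem_cell` (`T ∈ ac|b`);
* **THEOREM M″**: `fixMap_injOn`, **`card_fixedAccess_le`** (every source class `P`), **`card_nTwo_fixed_le`**
  (`w = c` on `N²`: `#{S ∈ N² : c ∈ B_{dist(a, D)}(a)} ≤ #ac|b`), `card_dcDefect_xb_fixed_le` (`w = x` on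
  `DB(xb)`: Lemma T's `M_x^{(k)}`).
-/

namespace PercRepro

open Finset

namespace MultiGraph

section FixedAccess

variable {V E : Type*} (G : MultiGraph V E)

open Classical in
/-- **mine-3's fixed-vertex map** `M_w^{(r+1)}(S) = S Δ (E_inc(D) ∖ E(w, B_r(a)))`: the closed cluster `D` of `c`
is flipped and sealed, except that the edges between `w` and the ball of radius `r` around `a` keep their state. -/
noncomputable def fixFlip (w c a : V) (r : ℕ) (ω : Config E) : Config E :=
  fun e => if e ∈ G.edgesAt (G.cluster ωᶜ c) ∧
      ¬ (e ∈ G.edgesAt ({w} : Set V) ∧ e ∈ G.edgesAt (G.ball ω a r)) then !ω e else ω e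

open Classical in
/-- The decoding of `τ` at radius `r`: flip the edges at `D' = Com_c(τ − B_r(a))` except those between `w` and
the ball. -/
noncomputable def fixDecode (w c a : V) (r : ℕ) (τ : Config E) : Config E :=
  fun e => if e ∈ G.edgesAt (G.decodeCluster c a r τ) ∧
      ¬ (e ∈ G.edgesAt ({w} : Set V) ∧ e ∈ G.edgesAt (G.ball τ a r)) then !τ e else τ e

/-- The fixed-vertex sources of the class `P`: `w` lies in `D = Com_c(S̄)` at distance `r + 1 = dist(a, D)`. -/
def FixedSource (P : Config E → Prop) (w c a : V) (ω : Config E) : Prop :=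
  P ω ∧ ∃ r, G.AtDist ω a (G.cluster ωᶜ c) r ∧ G.Conn ωᶜ c w ∧ w ∈ G.ball ω a (r + 1)

/-- The fixed-vertex map at the radius of the configuration. -/
noncomputable def fixMap (w c a : V) (ω : Config E) : Config E :=
  G.fixFlip w c a (G.radius c a ω) ω

variable {G}

/-- The map flips an edge at `D` that is not kept. -/
theorem fixFlip_apply_of_mem {w c a : V} {r : ℕ} {ω : Config E} {e : E}
    (he : e ∈ G.edgesAt (G.cluster ωᶜ c))
    (hk : ¬ (e ∈ G.edgesAt ({w} : Set V) ∧ e ∈ G.edgesAt (G.ball ω a r))) :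
    G.fixFlip w c a r ω e = !ω e := by
  simp [fixFlip, he, hk]

/-- The map keeps an edge between `w` and the ball. -/
theorem fixFlip_apply_of_kept {w c a : V} {r : ℕ} {ω : Config E} {e : E}
    (hw : e ∈ G.edgesAt ({w} : Set V)) (hB : e ∈ G.edgesAt (G.ball ω a r)) :
    G.fixFlip w c a r ω e = ω e := by
  simp [fixFlip, hw, hB]

/-- The map keeps every edge away from `D`. -/
theorem fixFlip_apply_of_notMem {w c a : V} {r : ℕ} {ω : Config E} {e : E}
    (he : e ∉ G.edgesAt (G.cluster ωᶜ c)) : G.fixFlip w c a r ω e = ω e := by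
  simp [fixFlip, he]

/-- **Distances `≤ r` agree in `S` and `M_w(S)`.** -/
theorem ball_fixFlip_eq {w c a : V} {ω : Config E} {r : ℕ} (h : G.AtDist ω a (G.cluster ωᶜ c) r)
    {n : ℕ} (hn : n ≤ r) : G.ball (G.fixFlip w c a r ω) a n = G.ball ω a n := by
  refine ball_eq_of_agree ?_
  intro m hm e he
  rw [fixFlip_apply_of_notMem
    (not_mem_edgesAt_cluster_of_mem_edgesAt_ball h (Nat.lt_of_lt_of_le hm hn) he)]

/-- **The radius is read off the image**: in `M_w(S)` the fixed vertex `w` is at distance exactly `r + 1`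
from `a` (the kept edge from the ball to `w` is open; nothing of `D` is closer). -/
theorem atDist_fixFlip_w {w c a : V} {ω : Config E} {r : ℕ} (h : G.AtDist ω a (G.cluster ωᶜ c) r)
    (hwD : G.Conn ωᶜ c w) (hw : w ∈ G.ball ω a (r + 1)) :
    G.AtDist (G.fixFlip w c a r ω) a ({w} : Set V) r := by
  constructor
  · intro u hu huw
    rw [ball_fixFlip_eq h le_rfl] at hu
    rw [Set.mem_singleton_iff] at huw
    rw [huw] at hu
    exact h.1 w hu hwD
  · rcases hw with hw | ⟨u, hu, e, he, hend⟩
    · exact absurd hwD (h.1 w hw)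
    · refine ⟨w, ?_, Set.mem_singleton w⟩
      have hT : G.fixFlip w c a r ω e = true := by
        rw [fixFlip_apply_of_kept (mem_edgesAt_of_openAdj_left (Set.mem_singleton w) (Or.symm hend))
          (mem_edgesAt_of_openAdj_left hu hend)]
        exact he
      refine mem_ball_succ_of_openAdj (n := r) ?_ ⟨e, hT, hend⟩
      rw [ball_fixFlip_eq h le_rfl]
      exact hu

/-- **`D = Com_c(M_w(S) − B_r(a))`**: the closed cluster is read off the image with the ball deleted. -/
theorem decodeCluster_fixFlip {w c a : V} {ω : Config E} {r : ℕ}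
    (h : G.AtDist ω a (G.cluster ωᶜ c) r) :
    G.decodeCluster c a r (G.fixFlip w c a r ω) = G.cluster ωᶜ c := by
  unfold decodeCluster
  rw [ball_fixFlip_eq h le_rfl]
  refine cluster_eq_of_agree ?_
  intro e he
  by_cases hB : e ∈ G.edgesAt (G.ball ω a r)
  · rw [closeAtSet_apply_of_mem hB]
    exact compl_eq_false_of_mem_edgesAt_of_mem_edgesAt (fun u hu => h.1 u hu) he hB
  · rw [closeAtSet_apply_of_notMem hB, fixFlip_apply_of_mem he (fun hk => hB hk.2), compl_apply_not]

/-- **The decoding of `M_w(S)` at its radius returns `S`.** -/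
theorem fixDecode_fixFlip {w c a : V} {ω : Config E} {r : ℕ} (h : G.AtDist ω a (G.cluster ωᶜ c) r) :
    G.fixDecode w c a r (G.fixFlip w c a r ω) = ω := by
  funext e
  unfold fixDecode
  rw [decodeCluster_fixFlip h, ball_fixFlip_eq h le_rfl]
  by_cases hflip : e ∈ G.edgesAt (G.cluster ωᶜ c) ∧
      ¬ (e ∈ G.edgesAt ({w} : Set V) ∧ e ∈ G.edgesAt (G.ball ω a r))
  · rw [if_pos hflip, fixFlip_apply_of_mem hflip.1 hflip.2, Bool.not_not]
  · rw [if_neg hflip]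
    by_cases heD : e ∈ G.edgesAt (G.cluster ωᶜ c)
    · have hk : e ∈ G.edgesAt ({w} : Set V) ∧ e ∈ G.edgesAt (G.ball ω a r) := by
        by_contra hk
        exact hflip ⟨heD, hk⟩
      exact fixFlip_apply_of_kept hk.1 hk.2
    · exact fixFlip_apply_of_notMem heD

/-- `D` is open-connected in `M_w(S)` (its closed edges are flipped; a kept edge at `D` is a boundary edge of
`D`, hence was open). -/
theorem conn_fixFlip_of_conn_compl {w c a : V} {ω : Config E} {r : ℕ}
    (h : G.AtDist ω a (G.cluster ωᶜ c) r) {v : V} (hv : G.Conn ωᶜ c v) :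
    G.Conn (G.fixFlip w c a r ω) c v := by
  refine conn_of_open_edges ?_ hv
  intro e he hmem
  by_cases hk : e ∈ G.edgesAt ({w} : Set V) ∧ e ∈ G.edgesAt (G.ball ω a r)
  · exact absurd he (by
      rw [compl_eq_false_of_mem_edgesAt_of_mem_edgesAt (fun u hu => h.1 u hu) hmem hk.2]
      exact Bool.false_ne_true)
  · rw [fixFlip_apply_of_mem hmem hk, ← compl_apply_not]
    exact he

/-- Every vertex of the open cluster of `c` in `M_w(S)` lies in `D` or is reached from `a` by an open walk of
`S` avoiding `D` (the only open exits of `D` are the kept edges into the ball). -/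
theorem conn_compl_or_connAvoid_of_conn_fixFlip {w c a : V} {ω : Config E} {r : ℕ}
    (h : G.AtDist ω a (G.cluster ωᶜ c) r) {v : V} (hv : G.Conn (G.fixFlip w c a r ω) c v) :
    G.Conn ωᶜ c v ∨ G.ConnAvoid ω (G.cluster ωᶜ c) a v := by
  refine Conn.induction
    (motive := fun x => G.Conn ωᶜ c x ∨ G.ConnAvoid ω (G.cluster ωᶜ c) a x)
    (Or.inl (Conn.refl G ωᶜ c)) ?_ hv
  intro x y _ hxy ih
  obtain ⟨e, he, hend⟩ := hxy
  by_cases hyD : G.Conn ωᶜ c y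
  · exact Or.inl hyD
  rcases ih with hxD | hxA
  · have heD : e ∈ G.edgesAt (G.cluster ωᶜ c) := mem_edgesAt_of_openAdj_left hxD hend
    by_cases hk : e ∈ G.edgesAt ({w} : Set V) ∧ e ∈ G.edgesAt (G.ball ω a r)
    · have hyB : y ∈ G.ball ω a r := by
        rcases hend with ⟨h1, h2⟩ | ⟨h1, h2⟩ <;> rcases hk.2 with hB | hB
        · exact absurd (by rw [h1]; exact hxD) (h.1 _ hB)
        · rw [← h2]; exact hB
        · rw [← h1]; exact hB
        · exact absurd (by rw [h2]; exact hxD) (h.1 _ hB)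
      exact Or.inr (connAvoid_of_mem_ball (fun u hu => h.1 u hu) hyB)
    · rw [fixFlip_apply_of_mem heD hk, ← compl_apply_not] at he
      have hyD' : y ∈ G.cluster ωᶜ c := by
        rcases hend with ⟨h1, h2⟩ | ⟨h1, h2⟩
        · rw [← h2]; exact G.snd_mem_cluster_of_open he (by rw [h1]; exact hxD)
        · rw [← h1]; exact G.fst_mem_cluster_of_open he (by rw [h2]; exact hxD)
      exact absurd hyD' hyD
  · have hxD : ¬ G.Conn ωᶜ c x := hxA.notMem_of_notMem (h.1 a (self_mem_ball ω a r))
    have heD : e ∉ G.edgesAt (G.cluster ωᶜ c) := notMem_edgesAt_of_notMem_of_notMem hend hxD hyD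
    rw [fixFlip_apply_of_notMem heD] at he
    exact Or.inr (hxA.tail ⟨⟨e, he, hend⟩, hxD, hyD⟩)

/-- **`M_w(S) ∈ ac|b`** for a fixed-vertex source with `b ∉ D` and no open `a`–`b` walk avoiding `D`. -/
theorem fixFlip_mem_cell {w c a b : V} {ω : Config E} {r : ℕ} (h : G.AtDist ω a (G.cluster ωᶜ c) r)
    (hwD : G.Conn ωᶜ c w) (hw : w ∈ G.ball ω a (r + 1)) (hb : ¬ G.Conn ωᶜ c b)
    (hav : ¬ G.ConnAvoid ω (G.cluster ωᶜ c) a b) :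
    G.Conn (G.fixFlip w c a r ω) c a ∧ ¬ G.Conn (G.fixFlip w c a r ω) c b := by
  constructor
  · obtain ⟨u, hu, huw⟩ := (atDist_fixFlip_w h hwD hw).2
    rw [Set.mem_singleton_iff] at huw
    rw [huw] at hu
    exact ((conn_fixFlip_of_conn_compl h hwD).trans (conn_of_mem_ball hu).symm)
  · intro hc
    rcases conn_compl_or_connAvoid_of_conn_fixFlip h hc with h1 | h1
    · exact hb h1
    · exact hav h1

/-- **THEOREM M″ (injectivity)**: the fixed-vertex map is injective on the fixed-vertex sources — the radius is
read off the image as the distance from `a` to `w`, and the decoding at that radius returns the source. -/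
theorem fixMap_injOn (P : Config E → Prop) (w c a : V) :
    Set.InjOn (G.fixMap w c a) {ω | G.FixedSource P w c a ω} := by
  intro ω hω ω' hω' hT
  obtain ⟨_, r, hr, hwD, hw⟩ := hω
  obtain ⟨_, r', hr', hwD', hw'⟩ := hω'
  have hZ : G.fixMap w c a ω = G.fixFlip w c a r ω := by
    unfold fixMap
    rw [radius_eq hr]
  have hZ' : G.fixMap w c a ω' = G.fixFlip w c a r' ω' := by
    unfold fixMap
    rw [radius_eq hr']
  rw [hZ, hZ'] at hT
  have hrr : r = r' := by
    have h1 := atDist_fixFlip_w hr hwD hw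
    have h2 := atDist_fixFlip_w hr' hwD' hw'
    rw [hT] at h1
    exact h1.unique h2
  subst hrr
  rw [← fixDecode_fixFlip hr, ← fixDecode_fixFlip hr', hT]

open Classical in
/-- **THEOREM M″ (the count)**: for every source class `P` with `b ∉ D` and no open `a`–`b` walk avoiding `D`,
the fixed-vertex sources are at most as many as the cell `ac|b`. -/
theorem card_fixedAccess_le [Fintype E] (P : Config E → Prop) (w c a b : V)
    (hP : ∀ ω, P ω → ¬ G.Conn ωᶜ c b ∧ ¬ G.ConnAvoid ω (G.cluster ωᶜ c) a b) :
    (univ.filter fun ω : Config E => G.FixedSource P w c a ω).card ≤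
      (univ.filter fun ω : Config E => G.Conn ω c a ∧ ¬ G.Conn ω c b).card := by
  refine Finset.card_le_card_of_injOn (G.fixMap w c a) ?_ ?_
  · intro ω hω
    simp only [Finset.coe_filter, Finset.mem_univ, true_and, Set.mem_setOf_eq] at hω ⊢
    obtain ⟨hPω, r, hr, hwD, hw⟩ := hω
    have hZ : G.fixMap w c a ω = G.fixFlip w c a r ω := by
      unfold fixMap
      rw [radius_eq hr]
    rw [hZ]
    exact fixFlip_mem_cell hr hwD hw (hP ω hPω).1 (hP ω hPω).2
  · intro ω hω ω' hω' hT
    simp only [Finset.coe_filter, Finset.mem_univ, true_and, Set.mem_setOf_eq] at hω hω'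
    exact fixMap_injOn P w c a hω hω' hT

open Classical in
/-- **THEOREM M″ for `N²`** (INBOX 5220): `#{S ∈ N² : c is a nearest vertex of Com_c(S̄) to a} ≤ #ac|b`. -/
theorem card_nTwo_fixed_le [Fintype E] (a b c : V) :
    (univ.filter fun ω : Config E => G.FixedSource (fun ω => G.NTwo ω a b c) c c a ω).card ≤
      (univ.filter fun ω : Config E => G.Conn ω c a ∧ ¬ G.Conn ω c b).card :=
  card_fixedAccess_le _ c c a b fun _ hω => ⟨hω.2.2.1, hω.2.2.2⟩

open Classical in
/-- **THEOREM M″ for `N²`, the `b`-side**: `#{S ∈ N² : c is a nearest vertex of Com_c(S̄) to b} ≤ #bc|a`. -/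
theorem card_nTwo_fixed_le' [Fintype E] (a b c : V) :
    (univ.filter fun ω : Config E => G.FixedSource (fun ω => G.NTwo ω a b c) c c b ω).card ≤
      (univ.filter fun ω : Config E => G.Conn ω c b ∧ ¬ G.Conn ω c a).card :=
  card_fixedAccess_le _ c c b a fun _ hω => ⟨hω.2.1, fun h => hω.2.2.2 h.symm⟩

open Classical in
/-- **The map `M_x^{(k)}` of Lemma T** (INBOX 5220, «for `DB(xb)`: also `x`»): on `DB(xb)`, the sources in
which `x` is a nearest vertex of `D` to `a` inject into `ac|b(H − e)`. -/
theorem card_dcDefect_xb_fixed_le [Fintype E] (a b c x : V) :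
    (univ.filter fun ω : Config E =>
        G.FixedSource (fun ω => G.DCDefect ω a b c x b) x c a ω).card ≤
      (univ.filter fun ω : Config E => G.Conn ω c a ∧ ¬ G.Conn ω c b).card :=
  card_fixedAccess_le _ x c a b fun _ hω =>
    ⟨(dcDefect_xb_imp hω).2.2.2, fun h => (dcDefect_xb_imp hω).1 h.conn⟩

end FixedAccess

end MultiGraph

end PercRepro
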